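import Summits.CriticalPhenomena.PercolationContinuityZ3.Theorems.PercNearOneGluingNoHeavyLowerTailCILOneSteiner
import Summits.CriticalPhenomena.PercolationContinuityZ3.Theorems.PercNearOneGluingAdditiveGluingTieLiftTwoAux
import HarnessLib

/-!
# `NoHeavyLowerTail` (stmt-CriticalPhenomena-4575) — tools for the two-Steiner-neighbours CIL (observer series law):
# pointwise gluing lemmas, the two-bond expansion, and the ENDPOINT inequality

Support file (prover `prim-hp-2`, deletion–contraction / pivotal-edge line; `--supports stmt-CriticalPhenomena-4575`).
No definitions, no named facts, no sorries.  Notation as in `…CILRelayGluing.lean` / `…CILOneSteiner.lean`: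
`μ_w = prodBernoulli w` on `Fin n`, relays `A`, observer `o ∉ A`, level `j`, `π(v) = {z ∈ A : v ↔ z}`,
`L_v = {1 ≤ |π(v)| ≤ j}`, `R_a = {|π(a)| ≤ j}`, `w⁰ = G − o` (`pinW w {pairs at o} ∅`), `e = s(o,x)`, `f = s(o,y)`.

* `reachable_insert_pair_iff`, `reachable_insert₂_iff_of_isolated`, `reachable_o_insert₂_iff_of_isolated` — pointwise:
  gluing an isolated `o` to `x` and to `y` induces, away from `o`, the same reachability as adding the pair `x–y`.
* `measureReal_congr_of_null`, `real_R_update_wzero_one` (opening one pair at an isolated non-relay changes no relay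
  lightness); the two-bond bilinear expansion is the tree's `tieLiftTwo_twoBond_decomp`.
* `endpoint_le` — THE ENDPOINT: if `c` maximises `a ↦ (1−ε)μ_{w⁰}(R_a) + εμ_{w⁰[e,f↦1]}(R_a)` then
  `(1−ε)μ_{w⁰[e↦1]}(L_o) + εμ_{w⁰[e,f↦1]}(L_o) ≤ (1−ε)μ_{w⁰}(R_c) + εμ_{w⁰[e,f↦1]}(R_c)`, i.e. CIL for the observer
  glued into `x` with the pair `o–y` of weight `ε`: after exchanging that pair for `x–y` this is `cil_oneSteiner`
  (prim-gen-swap) for the observer `x` with the single Steiner neighbour `y` in `(G − o) + xy(ε)`.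
The assembly (`cil_twoSteiner`) is `…CILTwoSteiner.lean`.
-/

noncomputable section

namespace Summit.CriticalPhenomena.PercolationContinuityZ3.Theorems

open MeasureTheory Set Literature.Probability.LatticeModels Literature.Probability.Percolation
open scoped Classical BigOperators

variable {n : ℕ}

namespace CILTwoSteiner

open CILOneSteiner ChampionStability MergeStability RelayNbhd

/-! ### Pointwise reachability after gluing the observer to two neighbours / adding the pair `x–y` -/

/-- Adding the pair `s(x,y)`: `a ↔ z` afterwards iff `a ↔ z` before, or `a` reaches `{x,y}` and `{x,y}` reaches `z`.
[folklore] -/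
theorem reachable_insert_pair_iff (ω : BondConfig (Fin n)) {x y : Fin n} (hxy : x ≠ y) (a z : Fin n) :
    (openGraph (insert s(x, y) ω)).Reachable a z ↔
      ((openGraph ω).Reachable a z ∨
        (((openGraph ω).Reachable a x ∨ (openGraph ω).Reachable a y) ∧
          ((openGraph ω).Reachable x z ∨ (openGraph ω).Reachable y z))) := by
  rw [ChampionStability.reachable_insert_iff ω hxy a z]
  simp only [Finset.mem_insert, Finset.mem_singleton, or_and_right, exists_or, exists_eq_left]

/-- Gluing an isolated `o` to `x` and `y`: for `a, z ≠ o`, `a ↔ z` afterwards iff `a ↔ z` before, or `a` reaches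
`{x,y}` and `{x,y}` reaches `z` — the same condition as after adding the pair `s(x,y)`. [folklore] -/
theorem reachable_insert₂_iff_of_isolated {ω : BondConfig (Fin n)} {o x y : Fin n} (hox : o ≠ x) (hoy : o ≠ y)
    (hiso : ∀ v : Fin n, v ≠ o → s(o, v) ∉ ω) {a z : Fin n} (hao : a ≠ o) (hzo : z ≠ o) :
    (openGraph (insert s(o, y) (insert s(o, x) ω))).Reachable a z ↔
      ((openGraph ω).Reachable a z ∨
        (((openGraph ω).Reachable a x ∨ (openGraph ω).Reachable a y) ∧
          ((openGraph ω).Reachable x z ∨ (openGraph ω).Reachable y z))) := by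
  have hyo : y ≠ o := fun h => hoy h.symm
  have h1 : (openGraph (insert s(o, x) ω)).Reachable a z ↔
      ((openGraph ω).Reachable a z ∨ ((openGraph ω).Reachable a x ∧ (openGraph ω).Reachable x z)) :=
    reachable_insert_iff_of_isolated hox hiso hao hzo
  have h2 : (openGraph (insert s(o, x) ω)).Reachable a o ↔ (openGraph ω).Reachable a x := by
    rw [reachable_insert_to_left_iff ω hox a]
    constructor
    · rintro (h | h)
      · exact absurd (eq_of_reachable_of_isolated hiso h.symm) hao
      · exact h
    · exact fun h => Or.inr h
  have h3 : (openGraph (insert s(o, x) ω)).Reachable a y ↔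
      ((openGraph ω).Reachable a y ∨ ((openGraph ω).Reachable a x ∧ (openGraph ω).Reachable x y)) :=
    reachable_insert_iff_of_isolated hox hiso hao hyo
  have h4 : (openGraph (insert s(o, x) ω)).Reachable o z ↔ (openGraph ω).Reachable x z :=
    reachable_o_insert_iff_of_isolated hox hiso hzo
  have h5 : (openGraph (insert s(o, x) ω)).Reachable y z ↔
      ((openGraph ω).Reachable y z ∨ ((openGraph ω).Reachable y x ∧ (openGraph ω).Reachable x z)) :=
    reachable_insert_iff_of_isolated hox hiso hyo hzo
  rw [ChampionStability.reachable_insert_iff (insert s(o, x) ω) hoy a z]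
  constructor
  · rintro (h | ⟨⟨s, hs, has⟩, ⟨t, ht, htz⟩⟩)
    · rcases h1.1 h with h | ⟨hax, hxz⟩
      · exact Or.inl h
      · exact Or.inr ⟨Or.inl hax, Or.inl hxz⟩
    · simp only [Finset.mem_insert, Finset.mem_singleton] at hs ht
      refine Or.inr ⟨?_, ?_⟩
      · rcases hs with rfl | rfl
        · exact Or.inl (h2.1 has)
        · rcases h3.1 has with h | ⟨h, -⟩
          · exact Or.inr h
          · exact Or.inl h
      · rcases ht with rfl | rfl
        · exact Or.inl (h4.1 htz)
        · rcases h5.1 htz with h | ⟨-, h⟩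
          · exact Or.inr h
          · exact Or.inl h
  · rintro (h | ⟨hs, ht⟩)
    · exact Or.inl (h1.2 (Or.inl h))
    · refine Or.inr ⟨?_, ?_⟩
      · rcases hs with h | h
        · exact ⟨o, by simp, h2.2 h⟩
        · exact ⟨y, by simp, h3.2 (Or.inl h)⟩
      · rcases ht with h | h
        · exact ⟨o, by simp, h4.2 h⟩
        · exact ⟨y, by simp, h5.2 (Or.inl h)⟩

/-- Gluing an isolated `o` to `x` and `y`: for `z ≠ o`, `o ↔ z` afterwards iff `x ↔ z` or `y ↔ z` before. [folklore] -/
theorem reachable_o_insert₂_iff_of_isolated {ω : BondConfig (Fin n)} {o x y : Fin n} (hox : o ≠ x) (hoy : o ≠ y)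
    (hiso : ∀ v : Fin n, v ≠ o → s(o, v) ∉ ω) {z : Fin n} (hzo : z ≠ o) :
    (openGraph (insert s(o, y) (insert s(o, x) ω))).Reachable o z ↔
      ((openGraph ω).Reachable x z ∨ (openGraph ω).Reachable y z) := by
  have hyo : y ≠ o := fun h => hoy h.symm
  have h4 : (openGraph (insert s(o, x) ω)).Reachable o z ↔ (openGraph ω).Reachable x z :=
    reachable_o_insert_iff_of_isolated hox hiso hzo
  have h5 : (openGraph (insert s(o, x) ω)).Reachable y z ↔
      ((openGraph ω).Reachable y z ∨ ((openGraph ω).Reachable y x ∧ (openGraph ω).Reachable x z)) :=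
    reachable_insert_iff_of_isolated hox hiso hyo hzo
  rw [ChampionStability.reachable_insert_left_iff (insert s(o, x) ω) hoy z, h4, h5]
  tauto

/-! ### Measure bookkeeping -/

/-- Two events that agree on an almost sure event have the same probability. [folklore] -/
theorem measureReal_congr_of_null (μ : Measure (BondConfig (Fin n))) [IsFiniteMeasure μ]
    (S T Z : Set (BondConfig (Fin n))) (hZ : μ.real Zᶜ = 0) (hST : S ∩ Z = T ∩ Z) : μ.real S = μ.real T := by
  have h1 : μ.real S ≤ μ.real T :=
    (real_le_real_inter_of_null μ S Z hZ).trans (by rw [hST]; exact measureReal_mono inter_subset_left)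
  have h2 : μ.real T ≤ μ.real S :=
    (real_le_real_inter_of_null μ T Z hZ).trans (by rw [← hST]; exact measureReal_mono inter_subset_left)
  exact le_antisymm h1 h2

/-! ### The endpoint: observer glued into `x`, pair `o–y` exchanged for `x–y` -/

/-- **Endpoint inequality.**  `o ∉ A`, `x ≠ y` non-relays `≠ o` whose positive-weight neighbours other than `o` are relays,
`w⁰ = G − o` (pairs at `o` closed), `e = s(o,x)`, `f = s(o,y)`, `ε ∈ [0,1]`.  If `c ∈ A` maximises
`a ↦ (1−ε)·μ_{w⁰}(R_a) + ε·μ_{w⁰[e↦1][f↦1]}(R_a)` over `A`, then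
`(1−ε)·μ_{w⁰[e↦1]}(L_o) + ε·μ_{w⁰[e↦1][f↦1]}(L_o) ≤ (1−ε)·μ_{w⁰}(R_c) + ε·μ_{w⁰[e↦1][f↦1]}(R_c)`:
both sides are the two sides of `cil_oneSteiner` for the observer `x` with Steiner neighbour `y` in `(G − o) + xy(ε)`.
[cite: KozmaNitzan2024, Thm 5 (p. 13) — CIL analogue, via `cil_oneSteiner`] -/
theorem endpoint_le (w : Sym2 (Fin n) → unitInterval) (A : Finset (Fin n)) (o x y : Fin n) (j : ℕ)
    (ho : o ∉ A) (hx : x ∉ A) (hy : y ∉ A) (hxo : x ≠ o) (hyo : y ≠ o) (hxy : x ≠ y)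
    (hxN : ∀ u : Fin n, u ≠ x → u ∉ A → u ≠ o → (w s(x, u) : ℝ) = 0)
    (hyN : ∀ u : Fin n, u ≠ y → u ∉ A → u ≠ o → (w s(y, u) : ℝ) = 0)
    (ε : unitInterval) (c : Fin n) (hc : c ∈ A)
    (hchamp : ∀ a ∈ A,
      (1 - (ε : ℝ)) * (prodBernoulli (pinW w {e : Sym2 (Fin n) | o ∈ e ∧ ¬ e.IsDiag} ∅)).real
          {ω : BondConfig (Fin n) | (A.filter fun z => ω ∈ openConn a z).card ≤ j} +
        (ε : ℝ) * (prodBernoulli (Function.update (Function.update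
          (pinW w {e : Sym2 (Fin n) | o ∈ e ∧ ¬ e.IsDiag} ∅) s(o, x) 1) s(o, y) 1)).real
          {ω : BondConfig (Fin n) | (A.filter fun z => ω ∈ openConn a z).card ≤ j} ≤
      (1 - (ε : ℝ)) * (prodBernoulli (pinW w {e : Sym2 (Fin n) | o ∈ e ∧ ¬ e.IsDiag} ∅)).real
          {ω : BondConfig (Fin n) | (A.filter fun z => ω ∈ openConn c z).card ≤ j} +
        (ε : ℝ) * (prodBernoulli (Function.update (Function.update
          (pinW w {e : Sym2 (Fin n) | o ∈ e ∧ ¬ e.IsDiag} ∅) s(o, x) 1) s(o, y) 1)).real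
          {ω : BondConfig (Fin n) | (A.filter fun z => ω ∈ openConn c z).card ≤ j}) :
    (1 - (ε : ℝ)) * (prodBernoulli (Function.update
        (pinW w {e : Sym2 (Fin n) | o ∈ e ∧ ¬ e.IsDiag} ∅) s(o, x) 1)).real
        {ω : BondConfig (Fin n) | 1 ≤ (A.filter fun z => ω ∈ openConn o z).card ∧
          (A.filter fun z => ω ∈ openConn o z).card ≤ j} +
      (ε : ℝ) * (prodBernoulli (Function.update (Function.update
        (pinW w {e : Sym2 (Fin n) | o ∈ e ∧ ¬ e.IsDiag} ∅) s(o, x) 1) s(o, y) 1)).real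
        {ω : BondConfig (Fin n) | 1 ≤ (A.filter fun z => ω ∈ openConn o z).card ∧
          (A.filter fun z => ω ∈ openConn o z).card ≤ j} ≤
    (1 - (ε : ℝ)) * (prodBernoulli (pinW w {e : Sym2 (Fin n) | o ∈ e ∧ ¬ e.IsDiag} ∅)).real
        {ω : BondConfig (Fin n) | (A.filter fun z => ω ∈ openConn c z).card ≤ j} +
      (ε : ℝ) * (prodBernoulli (Function.update (Function.update
        (pinW w {e : Sym2 (Fin n) | o ∈ e ∧ ¬ e.IsDiag} ∅) s(o, x) 1) s(o, y) 1)).real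
        {ω : BondConfig (Fin n) | (A.filter fun z => ω ∈ openConn c z).card ≤ j} := by
  haveI : ∀ u : Sym2 (Fin n) → unitInterval, IsProbabilityMeasure (prodBernoulli u) := fun u => inferInstance
  have hox : o ≠ x := fun h => hxo h.symm
  have hoy : o ≠ y := fun h => hyo h.symm
  have hyx : y ≠ x := fun h => hxy h.symm
  set w0 : Sym2 (Fin n) → unitInterval := pinW w {e : Sym2 (Fin n) | o ∈ e ∧ ¬ e.IsDiag} ∅ with hw0
  set μ0 := prodBernoulli w0 with hμ0
  set g : Sym2 (Fin n) := s(x, y) with hg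
  -- the pair `x–y` is closed in `G` (hence in `G − o`)
  have hg_not : g ∉ {e : Sym2 (Fin n) | o ∈ e ∧ ¬ e.IsDiag} := by
    rintro ⟨hoe, -⟩
    rcases Sym2.mem_iff.1 hoe with h | h
    · exact hox h
    · exact hoy h
  have hw0g : w0 g = 0 := by
    rw [hw0, pinW_apply_of_not_mem w ∅ hg_not, hg]
    exact Subtype.ext (hxN y hyx hy hyo)
  -- the transported weight function `w3 = (G − o) + xy(ε)`
  set w3 : Sym2 (Fin n) → unitInterval := Function.update w0 g ε with hw3
  have hw3_0 : Function.update w3 g 0 = w0 := by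
    rw [hw3, Function.update_idem, Function.update_eq_self_iff]; exact hw0g.symm
  have hw3_1 : Function.update w3 g 1 = Function.update w0 g 1 := by
    rw [hw3, Function.update_idem]
  have hw3g : (w3 g : ℝ) = ε := by rw [hw3, Function.update_self]
  have hdec : ∀ S : Set (BondConfig (Fin n)), (prodBernoulli w3).real S =
      (1 - (ε : ℝ)) * μ0.real S + (ε : ℝ) * (prodBernoulli (Function.update w0 g 1)).real S := by
    intro S
    rw [stub_oneBondDecomp_k15 n w3 g S, hw3g, hw3_0, hw3_1]
  -- neighbourhoods of `x` and `y` in `w3`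
  have hw0_off : ∀ u v : Fin n, u ≠ o → v ≠ o → w0 s(u, v) = w s(u, v) := by
    intro u v hu hv
    have hmem : s(u, v) ∉ {e : Sym2 (Fin n) | o ∈ e ∧ ¬ e.IsDiag} := by
      rintro ⟨hoe, -⟩
      rcases Sym2.mem_iff.1 hoe with h | h
      · exact hu h.symm
      · exact hv h.symm
    rw [hw0, pinW_apply_of_not_mem w ∅ hmem]
  have hxN3 : ∀ v : Fin n, v ≠ x → v ∉ A → v ≠ y → (w3 s(x, v) : ℝ) = 0 := by
    intro v hvx hvA hvy
    have hne : s(x, v) ≠ g := by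
      rw [hg]; intro h; exact hvy (Sym2.congr_right.1 h)
    rw [hw3, Function.update_of_ne hne]
    by_cases hvo : v = o
    · subst hvo
      rw [Sym2.eq_swap, hw0, pinW_star_mk w hxo]; rfl
    · rw [hw0_off x v hxo hvo]; exact hxN v hvx hvA hvo
  have hyN3 : ∀ u : Fin n, u ≠ y → u ∉ A → u ≠ x → (w3 s(y, u) : ℝ) = 0 := by
    intro u huy huA hux
    have hne : s(y, u) ≠ g := by
      rw [hg, Sym2.eq_swap]; intro h; exact hux (Sym2.congr_left.1 h)
    rw [hw3, Function.update_of_ne hne]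
    by_cases huo : u = o
    · subst huo
      rw [Sym2.eq_swap, hw0, pinW_star_mk w hyo]; rfl
    · rw [hw0_off y u hyo huo]; exact hyN u huy huA huo
  -- the almost sure event "`o` isolated" under `μ0`
  set Z : Set (BondConfig (Fin n)) := {ω | ∀ v : Fin n, v ≠ o → s(o, v) ∉ ω} with hZ
  have hZ0 : μ0.real Zᶜ = 0 := by rw [hμ0, hw0]; exact real_compl_isolated_eq_zero w o
  -- (T2) `L_o` under the double gluing = `L_x` after adding the pair `x–y`
  have hT2 : (prodBernoulli (Function.update (Function.update w0 s(o, x) 1) s(o, y) 1)).real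
      {ω : BondConfig (Fin n) | 1 ≤ (A.filter fun z => ω ∈ openConn o z).card ∧
        (A.filter fun z => ω ∈ openConn o z).card ≤ j} =
      (prodBernoulli (Function.update w0 g 1)).real
      {ω : BondConfig (Fin n) | 1 ≤ (A.filter fun z => ω ∈ openConn x z).card ∧
        (A.filter fun z => ω ∈ openConn x z).card ≤ j} := by
    rw [hw0, real_update_wzero_one_one w hxo hyo hxy, ← hw0, tieLiftOne_real_one_eq w0 g,
      Function.update_eq_self_iff.2 hw0g.symm, ← hμ0]
    refine measureReal_congr_of_null μ0 _ _ Z hZ0 ?_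
    ext ω
    simp only [mem_inter_iff, mem_setOf_eq, mem_preimage]
    constructor
    · rintro ⟨h, hω⟩
      have hfilt : (A.filter fun z => insert s(o, y) (insert s(o, x) ω) ∈ openConn o z) =
          (A.filter fun z => insert g ω ∈ openConn x z) := by
        refine Finset.filter_congr fun z hz => ?_
        have hzo : z ≠ o := fun h => ho (h ▸ hz)
        show (openGraph (insert s(o, y) (insert s(o, x) ω))).Reachable o z ↔ (openGraph (insert s(x, y) ω)).Reachable x z
        rw [reachable_o_insert₂_iff_of_isolated hox hoy hω hzo, ChampionStability.reachable_insert_left_iff ω hxy z]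
      rw [hfilt] at h
      exact ⟨h, hω⟩
    · rintro ⟨h, hω⟩
      have hfilt : (A.filter fun z => insert s(o, y) (insert s(o, x) ω) ∈ openConn o z) =
          (A.filter fun z => insert g ω ∈ openConn x z) := by
        refine Finset.filter_congr fun z hz => ?_
        have hzo : z ≠ o := fun h => ho (h ▸ hz)
        show (openGraph (insert s(o, y) (insert s(o, x) ω))).Reachable o z ↔ (openGraph (insert s(x, y) ω)).Reachable x z
        rw [reachable_o_insert₂_iff_of_isolated hox hoy hω hzo, ChampionStability.reachable_insert_left_iff ω hxy z]
      rw [hfilt]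
      exact ⟨h, hω⟩
  -- (T4) every `R_a` under the double gluing = `R_a` after adding the pair `x–y`
  have hT4 : ∀ a ∈ A, (prodBernoulli (Function.update (Function.update w0 s(o, x) 1) s(o, y) 1)).real
      {ω : BondConfig (Fin n) | (A.filter fun z => ω ∈ openConn a z).card ≤ j} =
      (prodBernoulli (Function.update w0 g 1)).real
      {ω : BondConfig (Fin n) | (A.filter fun z => ω ∈ openConn a z).card ≤ j} := by
    intro a ha
    have hao : a ≠ o := fun h => ho (h ▸ ha)
    rw [hw0, real_update_wzero_one_one w hxo hyo hxy, ← hw0, tieLiftOne_real_one_eq w0 g,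
      Function.update_eq_self_iff.2 hw0g.symm, ← hμ0]
    refine measureReal_congr_of_null μ0 _ _ Z hZ0 ?_
    ext ω
    simp only [mem_inter_iff, mem_setOf_eq, mem_preimage]
    have hfilt : ω ∈ Z → (A.filter fun z => insert s(o, y) (insert s(o, x) ω) ∈ openConn a z) =
        (A.filter fun z => insert g ω ∈ openConn a z) := by
      intro hω
      refine Finset.filter_congr fun z hz => ?_
      have hzo : z ≠ o := fun h => ho (h ▸ hz)
      show (openGraph (insert s(o, y) (insert s(o, x) ω))).Reachable a z ↔ (openGraph (insert s(x, y) ω)).Reachable a z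
      rw [reachable_insert₂_iff_of_isolated hox hoy hω hao hzo, reachable_insert_pair_iff ω hxy a z]
    constructor
    · rintro ⟨h, hω⟩
      rw [hfilt hω] at h
      exact ⟨h, hω⟩
    · rintro ⟨h, hω⟩
      rw [hfilt hω]
      exact ⟨h, hω⟩
  -- (T1) `L_o` under the single gluing `o ≡ x` = `L_x` in `G − o`
  have hT1 : (prodBernoulli (Function.update w0 s(o, x) 1)).real
      {ω : BondConfig (Fin n) | 1 ≤ (A.filter fun z => ω ∈ openConn o z).card ∧
        (A.filter fun z => ω ∈ openConn o z).card ≤ j} =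
      μ0.real {ω : BondConfig (Fin n) | 1 ≤ (A.filter fun z => ω ∈ openConn x z).card ∧
        (A.filter fun z => ω ∈ openConn x z).card ≤ j} := by
    rw [hw0, real_update_wzero_one w hxo, ← hw0, ← hμ0]
    refine measureReal_congr_of_null μ0 _ _ Z hZ0 ?_
    ext ω
    simp only [mem_inter_iff, mem_setOf_eq, mem_preimage]
    have hfilt : ω ∈ Z → (A.filter fun z => insert s(o, x) ω ∈ openConn o z) =
        (A.filter fun z => ω ∈ openConn x z) := by
      intro hω
      refine Finset.filter_congr fun z hz => ?_
      have hzo : z ≠ o := fun h => ho (h ▸ hz)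
      show (openGraph (insert s(o, x) ω)).Reachable o z ↔ (openGraph ω).Reachable x z
      exact reachable_o_insert_iff_of_isolated hox hω hzo
    constructor
    · rintro ⟨h, hω⟩
      rw [hfilt hω] at h
      exact ⟨h, hω⟩
    · rintro ⟨h, hω⟩
      rw [hfilt hω]
      exact ⟨h, hω⟩
  -- `c` is a champion of `w3`
  have hchamp3 : ∀ a ∈ A,
      (prodBernoulli w3).real {ω : BondConfig (Fin n) | (A.filter fun z => ω ∈ openConn a z).card ≤ j} ≤
        (prodBernoulli w3).real {ω : BondConfig (Fin n) | (A.filter fun z => ω ∈ openConn c z).card ≤ j} := by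
    intro a ha
    rw [hdec, hdec, ← hT4 a ha, ← hT4 c hc]
    exact hchamp a ha
  -- `cil_oneSteiner` for the observer `x` with Steiner neighbour `y` in `w3`
  have hcil := cil_oneSteiner w3 A x y j hx hy hyx hxN3 hyN3 c hc hchamp3
  rw [hdec, hdec, ← hT4 c hc] at hcil
  rw [hT1, hT2]
  exact hcil


/-! ### The base case: the observer has only the two Steiner pairs (observer series law) -/

/-- Opening one pair `s(o,v)` at an otherwise isolated non-relay `o` does not change any relay lightness. [folklore] -/
theorem real_R_update_wzero_one (w : Sym2 (Fin n) → unitInterval) (A : Finset (Fin n)) (o v a : Fin n) (j : ℕ)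
    (ho : o ∉ A) (hvo : v ≠ o) (ha : a ∈ A) :
    (prodBernoulli (Function.update (pinW w {e : Sym2 (Fin n) | o ∈ e ∧ ¬ e.IsDiag} ∅) s(o, v) 1)).real
        {ω : BondConfig (Fin n) | (A.filter fun z => ω ∈ openConn a z).card ≤ j} =
      (prodBernoulli (pinW w {e : Sym2 (Fin n) | o ∈ e ∧ ¬ e.IsDiag} ∅)).real
        {ω : BondConfig (Fin n) | (A.filter fun z => ω ∈ openConn a z).card ≤ j} := by
  haveI : ∀ u : Sym2 (Fin n) → unitInterval, IsProbabilityMeasure (prodBernoulli u) := fun u => inferInstance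
  have hov : o ≠ v := fun h => hvo h.symm
  have hao : a ≠ o := fun h => ho (h ▸ ha)
  rw [real_update_wzero_one w hvo]
  refine measureReal_congr_of_null _ _ _ {ω | ∀ u : Fin n, u ≠ o → s(o, u) ∉ ω}
    (real_compl_isolated_eq_zero w o) ?_
  ext ω
  simp only [mem_inter_iff, mem_setOf_eq, mem_preimage]
  have hfilt : (∀ u : Fin n, u ≠ o → s(o, u) ∉ ω) →
      (A.filter fun z => insert s(o, v) ω ∈ openConn a z) = (A.filter fun z => ω ∈ openConn a z) := by
    intro hω
    refine Finset.filter_congr fun z hz => ?_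
    have hzo : z ≠ o := fun h => ho (h ▸ hz)
    show (openGraph (insert s(o, v) ω)).Reachable a z ↔ (openGraph ω).Reachable a z
    rw [reachable_insert_iff_of_isolated hov hω hao hzo]
    constructor
    · rintro (h | ⟨h1, h2⟩)
      · exact h
      · exact h1.trans h2
    · exact fun h => Or.inl h
  constructor
  · rintro ⟨h, hω⟩
    rw [hfilt hω] at h
    exact ⟨h, hω⟩
  · rintro ⟨h, hω⟩
    rw [hfilt hω]
    exact ⟨h, hω⟩

end CILTwoSteiner

end Summit.CriticalPhenomena.PercolationContinuityZ3.Theorems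

end
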